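import Summits.QuantumFields.YangMills.Theorems.BalabanUVNodesN19CoreCommonStep

/-!
# BalabanUVNodes ∕ N19 (NE7) — THE SOURCE FLOOR: no step common to both runs can push `Core`'s width below the SOURCE SEPARATION of the log-ratio
# ranges it receives (the per-source interval hull of `log(Q∕P)` only SHRINKS under a common non-negative step), hence an unsummable source separation
# born at the finest step forbids N19's edge for the images of ANY chain of common steps

Cell `pub-ymgap` (HUMAN RULING D-0062 Track A; D-0149 width seats), seat `pub-ymgap-dag-n19-w2` (WIDTH SEAT 2 of 3 on NODE n19 = NE7), generation
g6, CLAIM-3 (INBOX).  Route `Summits/QuantumFields/YangMills/Theses/BalabanUVNodes.lean`, key item K3⁷ `SpineGivenEndpointR13SepCoPH`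
(stmt-QuantumFields-20544; N19′ conjunct of v5 stub 2); filed `--kind proof --supports … --as helper`.  COUNT-NEUTRAL.  THEOREMS ONLY (0 `def`, 0 `sorry`).
ADDITIVE — imports this seat's g6 `…N19CoreCommonStep` (p618919: `sum_eq_sum_good`; through it dag-n19-e `N19CoreMetric.logRatio_sub_logRatio_le_of_core`
and `Spine/NE7/Targets`: `Core`) ONLY; modifies nothing.

WHY.  `…N19CoreCommonStep` §2 showed that a PURE source discrepancy `Q = e^{f(K,t)}·P` is rigid under every common step.  This file is the general,
quantitative statement behind it: at each source value `t` the INTERVAL HULL `[inf_τ log(Q∕P)(t,τ), sup_τ log(Q∕P)(t,τ)]` of the two-run log-ratio over the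
good classes can only SHRINK under a common non-negative step (the image ratio `(M•Q)∕(M•P)` is a weighted mean of the ratios `Q∕P`), so two source values
whose hulls are SEPARATED by `D` stay separated by `D` after any number of common steps — and `Core`'s radius of the images is `≥ D∕2`
(dag-n19-e's necessity `logRatio_sub_logRatio_le_of_core`).  Birkhoff's contraction (`…N19CoreCommonStep` §3–§4) shrinks each hull; it cannot move them
towards each other.  So the summability of `δ_K` along the two-run comparison is decided by the source separation BORN at run B's extra finest step (node
U5's DECL target ∕ the observable's renormalisation), exactly as [GawedzkiKupiainen1985]'s remark quoted in `T4MatchingAssembly` says for the marginal.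
* §1 [folklore] `exp_mul_sum_le_sum_of_le` ∕ `sum_le_exp_mul_sum_of_le` (a common non-negative step preserves one-sided log-ratio bounds: the hull shrinks)
  · `logRatio_kernel_ge_of_ge` ∕ `logRatio_kernel_le_of_le` (log form on positive images).
* §2 [folklore] ★★ `sourceGap_le_two_mul_radius_of_core_kernel` — THE FLOOR: if `Core l₀ vol T′ Bad′ (M•P) (M•Q) δ` holds for the images under a common
  non-negative step (good rows vanishing on bad columns, positive images, good rows non-empty), then for all `|t|, |t′| ≤ l₀` and all `Lo, Hi` with
  `Lo ≤ log(Q∕P)(t, ·)` on the good classes at `t` and `log(Q∕P)(t′, ·) ≤ Hi` on the good classes at `t′`: `Lo − Hi ≤ 2·vol·δ_K`.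
  ★ `sourceGap_le_two_mul_radius_of_core` — the same for `(P, Q)` themselves (no step; dag-n19-e's necessity read with one-sided bounds).
* §3 [folklore] `summable_of_le_two_mul` · ★★ `not_coreEdge_kernel_of_unsummable_sourceGap` — choose at every level `K` two admissible source values
  `t K, t′ K` and a non-negative separation `D K ≤ Lo K − Hi K` between the hull of `log(Q∕P)` at `t K` (from below) and at `t′ K` (from above) on the good
  classes of the cores BEFORE the step; if `D` is NOT summable then the images under the common step admit NO `δ` with `Core … (M•P) (M•Q) δ ∧ Summable δ`.

HONEST FRAMING.  Count-neutral helper; [folklore] finite-sum ∕ real-analysis bookkeeping on hypothesis SHAPES produced by nobody; ZERO Bałaban content (neither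
run's cores nor any RG step is instantiated); NE2–NE7 ∕ NE1′ NOT PRINTED for d = 4 ∕ NOT proved; N19 NOT discharged; K3⁷ OPEN, v5 untouched, not claimed;
counts UNMOVED (typed 28∕28 · discharged 5∕27, A 5∕28); no count claim.  One finite 𝕋⁴ programme at fixed ε, Bałaban AS PRINTED; R4 closes the conditional
finite-𝕋⁴ rung `BalabanLadder.UV` only — the YM mass gap (Clay) is NOT proved by any of this; nothing continuum ∕ ℝ⁴ ∕ OS.  No `def`, no `instance`, no
`sorry`; standard axioms.
-/

noncomputable section

open Finset Real
open Summit.QuantumFields.BalabanUV.T4Continuum.Spine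
open Summit.QuantumFields.YangMills.BalabanUVNodes.N19CoreCommonStep (sum_eq_sum_good)
open Summit.QuantumFields.YangMills.BalabanUVNodes.N19CoreMetric (logRatio_sub_logRatio_le_of_core)

namespace Summit.QuantumFields.YangMills.BalabanUVNodes.N19CoreCommonStepFloor

/-! ## §1 A common non-negative step preserves one-sided log-ratio bounds (the per-source hull shrinks) -/

section Hull

variable {ι : Type*} {s : Finset ι} {w P Q : ι → ℝ} {Lo Hi : ℝ}

/-- lower bounds pass: `e^{Lo}·P ≤ Q` on `s`, `w ≥ 0` ⇒ `e^{Lo}·Σ w P ≤ Σ w Q`. [folklore] -/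
theorem exp_mul_sum_le_sum_of_le (hw : ∀ τ ∈ s, 0 ≤ w τ) (h : ∀ τ ∈ s, Real.exp Lo * P τ ≤ Q τ) :
    Real.exp Lo * ∑ τ ∈ s, w τ * P τ ≤ ∑ τ ∈ s, w τ * Q τ := by
  rw [Finset.mul_sum]
  refine Finset.sum_le_sum fun τ hτ => ?_
  calc Real.exp Lo * (w τ * P τ) = w τ * (Real.exp Lo * P τ) := by ring
    _ ≤ w τ * Q τ := mul_le_mul_of_nonneg_left (h τ hτ) (hw τ hτ)

/-- upper bounds pass: `Q ≤ e^{Hi}·P` on `s`, `w ≥ 0` ⇒ `Σ w Q ≤ e^{Hi}·Σ w P`. [folklore] -/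
theorem sum_le_exp_mul_sum_of_le (hw : ∀ τ ∈ s, 0 ≤ w τ) (h : ∀ τ ∈ s, Q τ ≤ Real.exp Hi * P τ) :
    ∑ τ ∈ s, w τ * Q τ ≤ Real.exp Hi * ∑ τ ∈ s, w τ * P τ := by
  rw [Finset.mul_sum]
  refine Finset.sum_le_sum fun τ hτ => ?_
  calc w τ * Q τ ≤ w τ * (Real.exp Hi * P τ) := mul_le_mul_of_nonneg_left (h τ hτ) (hw τ hτ)
    _ = Real.exp Hi * (w τ * P τ) := by ring

/-- log form, lower: positive `P, Q` on `s` with `Lo ≤ log Q − log P`, `w ≥ 0`, positive image of `P` ⇒ `Lo ≤ log Σ w Q − log Σ w P`. [folklore] -/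
theorem logRatio_kernel_ge_of_ge (hw : ∀ τ ∈ s, 0 ≤ w τ) (hP : ∀ τ ∈ s, 0 < P τ) (hQ : ∀ τ ∈ s, 0 < Q τ)
    (h : ∀ τ ∈ s, Lo ≤ Real.log (Q τ) - Real.log (P τ)) (hwP : 0 < ∑ τ ∈ s, w τ * P τ) :
    Lo ≤ Real.log (∑ τ ∈ s, w τ * Q τ) - Real.log (∑ τ ∈ s, w τ * P τ) := by
  have h' : ∀ τ ∈ s, Real.exp Lo * P τ ≤ Q τ := fun τ hτ => by
    have := h τ hτ
    have e : Real.exp (Lo + Real.log (P τ)) = Real.exp Lo * P τ := by rw [Real.exp_add, Real.exp_log (hP τ hτ)]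
    rw [← e, ← Real.exp_log (hQ τ hτ)]
    exact Real.exp_le_exp.2 (by linarith)
  have hs := exp_mul_sum_le_sum_of_le hw h'
  have hl := Real.log_le_log (mul_pos (Real.exp_pos _) hwP) hs
  rw [Real.log_mul (Real.exp_pos _).ne' hwP.ne', Real.log_exp] at hl
  linarith

/-- log form, upper: positive `P, Q` on `s` with `log Q − log P ≤ Hi`, `w ≥ 0`, positive images ⇒ `log Σ w Q − log Σ w P ≤ Hi`. [folklore] -/
theorem logRatio_kernel_le_of_le (hw : ∀ τ ∈ s, 0 ≤ w τ) (hP : ∀ τ ∈ s, 0 < P τ) (hQ : ∀ τ ∈ s, 0 < Q τ)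
    (h : ∀ τ ∈ s, Real.log (Q τ) - Real.log (P τ) ≤ Hi) (hwP : 0 < ∑ τ ∈ s, w τ * P τ) (hwQ : 0 < ∑ τ ∈ s, w τ * Q τ) :
    Real.log (∑ τ ∈ s, w τ * Q τ) - Real.log (∑ τ ∈ s, w τ * P τ) ≤ Hi := by
  have h' : ∀ τ ∈ s, Q τ ≤ Real.exp Hi * P τ := fun τ hτ => by
    have := h τ hτ
    have e : Real.exp (Hi + Real.log (P τ)) = Real.exp Hi * P τ := by rw [Real.exp_add, Real.exp_log (hP τ hτ)]
    rw [← e, ← Real.exp_log (hQ τ hτ)]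
    exact Real.exp_le_exp.2 (by linarith)
  have hs := sum_le_exp_mul_sum_of_le hw h'
  have hl := Real.log_le_log hwQ hs
  rw [Real.log_mul (Real.exp_pos _).ne' hwP.ne', Real.log_exp] at hl
  linarith

end Hull

/-! ## §2 The floor: `Core`'s radius (of the runs, or of their images under a common step) is at least half the source separation -/

section Floor

variable {ι κ : Type*} [DecidableEq ι] [DecidableEq κ] {l₀ vol : ℝ} {T : ℕ → Finset ι} {Bad : ℕ → ℝ → Finset ι}
  {T' : ℕ → Finset κ} {Bad' : ℕ → ℝ → Finset κ} {P Q : ℕ → ℝ → ι → ℝ} {δ : ℕ → ℝ} {M : ℕ → ℝ → κ → ι → ℝ}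

/-- **★ THE SOURCE SEPARATION IS A FLOOR FOR `Core`'s RADIUS** [folklore] (dag-n19-e's necessity with one-sided letters): if `Core l₀ vol T Bad P Q δ` with
positive cores, and at level `K` the log-ratio is `≥ Lo` on the good classes at source `t` and `≤ Hi` on the good classes at source `t′` (both non-empty),
then `Lo − Hi ≤ 2·vol·δ_K`. -/
theorem sourceGap_le_two_mul_radius_of_core (h : NE7.Core l₀ vol T Bad P Q δ)
    (hP : ∀ (K : ℕ) (t : ℝ), |t| ≤ l₀ → ∀ τ ∈ T K \ Bad K t, 0 < P K t τ) (K : ℕ) {t t' Lo Hi : ℝ} (ht : |t| ≤ l₀) (ht' : |t'| ≤ l₀)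
    (hne : (T K \ Bad K t).Nonempty) (hne' : (T K \ Bad K t').Nonempty)
    (hLo : ∀ τ ∈ T K \ Bad K t, Lo ≤ Real.log (Q K t τ) - Real.log (P K t τ))
    (hHi : ∀ τ' ∈ T K \ Bad K t', Real.log (Q K t' τ') - Real.log (P K t' τ') ≤ Hi) :
    Lo - Hi ≤ 2 * (vol * δ K) := by
  obtain ⟨τ, hτ⟩ := hne
  obtain ⟨τ', hτ'⟩ := hne'
  have h1 := logRatio_sub_logRatio_le_of_core h K ht ht' hτ hτ' (hP K t ht τ hτ) (hP K t' ht' τ' hτ')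
  linarith [hLo τ hτ, hHi τ' hτ']

/-- **★★ THE FLOOR SURVIVES EVERY COMMON NON-NEGATIVE STEP** [folklore].  Positive cores `P, Q`; a common non-negative source-dependent kernel `M` whose good
rows vanish on the bad columns and give positive images, good rows non-empty at `t` and `t′`; if the IMAGES satisfy `Core l₀ vol T′ Bad′ (M•P) (M•Q) δ`, then
for every `Lo ≤ log(Q∕P)(t, ·)|_{good}` and `Hi ≥ log(Q∕P)(t′, ·)|_{good}` (letters on the cores BEFORE the step): `Lo − Hi ≤ 2·vol·δ_K`.  The per-source
hulls only shrink (§1), so the separation between two source values is inherited by the images — Birkhoff contraction shrinks hulls, never their distance. -/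
theorem sourceGap_le_two_mul_radius_of_core_kernel
    (h : NE7.Core l₀ vol T' Bad' (fun K t σ => ∑ τ ∈ T K, M K t σ τ * P K t τ) (fun K t σ => ∑ τ ∈ T K, M K t σ τ * Q K t τ) δ)
    (hP : ∀ (K : ℕ) (t : ℝ), |t| ≤ l₀ → ∀ τ ∈ T K \ Bad K t, 0 < P K t τ)
    (hQ : ∀ (K : ℕ) (t : ℝ), |t| ≤ l₀ → ∀ τ ∈ T K \ Bad K t, 0 < Q K t τ)
    (hM : ∀ (K : ℕ) (t : ℝ), |t| ≤ l₀ → ∀ σ ∈ T' K \ Bad' K t, ∀ τ ∈ T K \ Bad K t, 0 ≤ M K t σ τ)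
    (hsupp : ∀ (K : ℕ) (t : ℝ), |t| ≤ l₀ → ∀ σ ∈ T' K \ Bad' K t, ∀ τ ∈ T K, τ ∈ Bad K t → M K t σ τ = 0)
    (hMP : ∀ (K : ℕ) (t : ℝ), |t| ≤ l₀ → ∀ σ ∈ T' K \ Bad' K t, 0 < ∑ τ ∈ T K, M K t σ τ * P K t τ)
    (hMQ : ∀ (K : ℕ) (t : ℝ), |t| ≤ l₀ → ∀ σ ∈ T' K \ Bad' K t, 0 < ∑ τ ∈ T K, M K t σ τ * Q K t τ)
    (K : ℕ) {t t' Lo Hi : ℝ} (ht : |t| ≤ l₀) (ht' : |t'| ≤ l₀)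
    (hne : (T' K \ Bad' K t).Nonempty) (hne' : (T' K \ Bad' K t').Nonempty)
    (hLo : ∀ τ ∈ T K \ Bad K t, Lo ≤ Real.log (Q K t τ) - Real.log (P K t τ))
    (hHi : ∀ τ' ∈ T K \ Bad K t', Real.log (Q K t' τ') - Real.log (P K t' τ') ≤ Hi) :
    Lo - Hi ≤ 2 * (vol * δ K) := by
  refine sourceGap_le_two_mul_radius_of_core h hMP K ht ht' hne hne' (fun σ hσ => ?_) (fun σ' hσ' => ?_)
  · have hp := hMP K t ht σ hσ
    rw [sum_eq_sum_good (P K t) (hsupp K t ht σ hσ)] at hp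
    rw [sum_eq_sum_good (Q K t) (hsupp K t ht σ hσ), sum_eq_sum_good (P K t) (hsupp K t ht σ hσ)]
    exact logRatio_kernel_ge_of_ge (hM K t ht σ hσ) (hP K t ht) (hQ K t ht) hLo hp
  · have hp := hMP K t' ht' σ' hσ'
    have hq := hMQ K t' ht' σ' hσ'
    rw [sum_eq_sum_good (P K t') (hsupp K t' ht' σ' hσ')] at hp
    rw [sum_eq_sum_good (Q K t') (hsupp K t' ht' σ' hσ')] at hq
    rw [sum_eq_sum_good (Q K t') (hsupp K t' ht' σ' hσ'), sum_eq_sum_good (P K t') (hsupp K t' ht' σ' hσ')]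
    exact logRatio_kernel_le_of_le (hM K t' ht' σ' hσ') (hP K t' ht') (hQ K t' ht') hHi hp hq

/-- **★ THE PER-SOURCE HULL LETTERS PASS THE STEP** [folklore] (so the floor propagates along any CHAIN of common steps by induction): lower letters
`Lo ≤ log(Q∕P)(t,·)` and upper letters `log(Q∕P)(t,·) ≤ Hi` on the good classes are inherited by the images on the good rows. -/
theorem hull_kernel
    (hP : ∀ (K : ℕ) (t : ℝ), |t| ≤ l₀ → ∀ τ ∈ T K \ Bad K t, 0 < P K t τ)
    (hQ : ∀ (K : ℕ) (t : ℝ), |t| ≤ l₀ → ∀ τ ∈ T K \ Bad K t, 0 < Q K t τ)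
    (hM : ∀ (K : ℕ) (t : ℝ), |t| ≤ l₀ → ∀ σ ∈ T' K \ Bad' K t, ∀ τ ∈ T K \ Bad K t, 0 ≤ M K t σ τ)
    (hsupp : ∀ (K : ℕ) (t : ℝ), |t| ≤ l₀ → ∀ σ ∈ T' K \ Bad' K t, ∀ τ ∈ T K, τ ∈ Bad K t → M K t σ τ = 0)
    (hMP : ∀ (K : ℕ) (t : ℝ), |t| ≤ l₀ → ∀ σ ∈ T' K \ Bad' K t, 0 < ∑ τ ∈ T K, M K t σ τ * P K t τ)
    (hMQ : ∀ (K : ℕ) (t : ℝ), |t| ≤ l₀ → ∀ σ ∈ T' K \ Bad' K t, 0 < ∑ τ ∈ T K, M K t σ τ * Q K t τ)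
    (K : ℕ) {t Lo Hi : ℝ} (ht : |t| ≤ l₀)
    (hLo : ∀ τ ∈ T K \ Bad K t, Lo ≤ Real.log (Q K t τ) - Real.log (P K t τ))
    (hHi : ∀ τ ∈ T K \ Bad K t, Real.log (Q K t τ) - Real.log (P K t τ) ≤ Hi) :
    ∀ σ ∈ T' K \ Bad' K t,
      Lo ≤ Real.log (∑ τ ∈ T K, M K t σ τ * Q K t τ) - Real.log (∑ τ ∈ T K, M K t σ τ * P K t τ) ∧
        Real.log (∑ τ ∈ T K, M K t σ τ * Q K t τ) - Real.log (∑ τ ∈ T K, M K t σ τ * P K t τ) ≤ Hi := by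
  intro σ hσ
  have hp := hMP K t ht σ hσ
  have hq := hMQ K t ht σ hσ
  rw [sum_eq_sum_good (P K t) (hsupp K t ht σ hσ)] at hp
  rw [sum_eq_sum_good (Q K t) (hsupp K t ht σ hσ)] at hq
  rw [sum_eq_sum_good (Q K t) (hsupp K t ht σ hσ), sum_eq_sum_good (P K t) (hsupp K t ht σ hσ)]
  exact ⟨logRatio_kernel_ge_of_ge (hM K t ht σ hσ) (hP K t ht) (hQ K t ht) hLo hp,
    logRatio_kernel_le_of_le (hM K t ht σ hσ) (hP K t ht) (hQ K t ht) hHi hp hq⟩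

end Floor

/-! ## §3 An unsummable source separation forbids the edge for the images of any common step -/

section Edge

variable {ι κ : Type*} [DecidableEq ι] [DecidableEq κ] {l₀ vol : ℝ} {T : ℕ → Finset ι} {Bad : ℕ → ℝ → Finset ι}
  {T' : ℕ → Finset κ} {Bad' : ℕ → ℝ → Finset κ} {P Q : ℕ → ℝ → ι → ℝ} {M : ℕ → ℝ → κ → ι → ℝ} {D : ℕ → ℝ} {t t' : ℕ → ℝ}

/-- summability bookkeeping: `0 ≤ D K ≤ 2·vol·δ K` for all `K` and `Summable δ` ⇒ `Summable D`. [folklore] -/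
theorem summable_of_le_two_mul {δ : ℕ → ℝ} (hδ : Summable δ) (hD : ∀ K, 0 ≤ D K) (hle : ∀ K, D K ≤ 2 * (vol * δ K)) :
    Summable D := by
  refine Summable.of_nonneg_of_le hD (fun K => hle K) ?_
  exact (hδ.mul_left vol).mul_left 2

/-- **★★ NO COMMON STEP RESCUES AN UNSUMMABLE SOURCE SEPARATION** [folklore].  At every level `K` pick two admissible source values `t K`, `t′ K` and a
non-negative separation `D K` between the log-ratio hull at `t K` (from below) and at `t′ K` (from above) on the good classes of the cores `(P, Q)`; if
`D` is NOT summable, then the images under a common non-negative step (hypotheses of `sourceGap_le_two_mul_radius_of_core_kernel`) admit NO `δ` with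
`Core l₀ vol T′ Bad′ (M•P) (M•Q) δ ∧ Summable δ` — N19's edge fails for the images exactly as it fails for the cores. -/
theorem not_coreEdge_kernel_of_unsummable_sourceGap
    (hP : ∀ (K : ℕ) (t : ℝ), |t| ≤ l₀ → ∀ τ ∈ T K \ Bad K t, 0 < P K t τ)
    (hQ : ∀ (K : ℕ) (t : ℝ), |t| ≤ l₀ → ∀ τ ∈ T K \ Bad K t, 0 < Q K t τ)
    (hM : ∀ (K : ℕ) (t : ℝ), |t| ≤ l₀ → ∀ σ ∈ T' K \ Bad' K t, ∀ τ ∈ T K \ Bad K t, 0 ≤ M K t σ τ)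
    (hsupp : ∀ (K : ℕ) (t : ℝ), |t| ≤ l₀ → ∀ σ ∈ T' K \ Bad' K t, ∀ τ ∈ T K, τ ∈ Bad K t → M K t σ τ = 0)
    (hMP : ∀ (K : ℕ) (t : ℝ), |t| ≤ l₀ → ∀ σ ∈ T' K \ Bad' K t, 0 < ∑ τ ∈ T K, M K t σ τ * P K t τ)
    (hMQ : ∀ (K : ℕ) (t : ℝ), |t| ≤ l₀ → ∀ σ ∈ T' K \ Bad' K t, 0 < ∑ τ ∈ T K, M K t σ τ * Q K t τ)
    (ht : ∀ K, |t K| ≤ l₀) (ht' : ∀ K, |t' K| ≤ l₀)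
    (hne : ∀ K, (T' K \ Bad' K (t K)).Nonempty) (hne' : ∀ K, (T' K \ Bad' K (t' K)).Nonempty)
    (hD : ∀ K, 0 ≤ D K)
    (hsep : ∀ K, ∃ Lo Hi : ℝ, D K ≤ Lo - Hi ∧ (∀ τ ∈ T K \ Bad K (t K), Lo ≤ Real.log (Q K (t K) τ) - Real.log (P K (t K) τ)) ∧
      ∀ τ' ∈ T K \ Bad K (t' K), Real.log (Q K (t' K) τ') - Real.log (P K (t' K) τ') ≤ Hi)
    (hns : ¬ Summable D) :
    ¬ ∃ δ : ℕ → ℝ, NE7.Core l₀ vol T' Bad' (fun K t σ => ∑ τ ∈ T K, M K t σ τ * P K t τ)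
      (fun K t σ => ∑ τ ∈ T K, M K t σ τ * Q K t τ) δ ∧ Summable δ := by
  rintro ⟨δ, hcore, hδ⟩
  refine hns (summable_of_le_two_mul (vol := vol) hδ hD fun K => ?_)
  obtain ⟨Lo, Hi, hDK, hLo, hHi⟩ := hsep K
  exact hDK.trans (sourceGap_le_two_mul_radius_of_core_kernel hcore hP hQ hM hsupp hMP hMQ K (ht K) (ht' K) (hne K) (hne' K) hLo hHi)

end Edge

end Summit.QuantumFields.YangMills.BalabanUVNodes.N19CoreCommonStepFloor

end
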